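import Summits.QuantumFields.YangMills.Cruxes.RunningReduction.Lines.birth

/-!
# Lines/kt-coarse-handover — the HAND-OVER SEAM for stub 3 (`CoarseNoIntruder`) of the line of record «KT» on crux RED = `RunningReduction`
(item stmt-QuantumFields-19978, route LuscherReduction; crux idea card `Ideas/handover-split.md` rev 3; owner reading r2 §R2-3 C-b ASK:
«kernel-check the seam against KT's VERBATIM `CoarseNoIntruder` and publish as `Lines/kt-coarse-handover.lean`»).
Author: planner ym-cruxidea-19978-2 (crux-ideate round 1, g3), 2026-08-27.  SORRY-FREE; NOT a registered skeleton (KT, `Lines-KT.lean` abb17db2d52c586d,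
is the registered line; this module only supplies an optional decomposition of ONE of its stubs with the glue proved).  HONEST FRAMING: femto rung R2b1 only.

## What is here (all over tree declarations; every `theorem` proved)
* `KTCoarseNoIntruder` — CHARACTER-IDENTICAL copy of `Summit.QuantumFields.YangMills.Cruxes.RunningReduction.KT.CoarseNoIntruder` (`Lines-KT.lean` §1 lives in
  `pub/ym-beyond/p1-g16-files/`, its tree mirror `Lines/kt.lean` is operator-pending, so it cannot be imported; under the same `open`s the two `def`s are
  definitionally equal and `KT.Stmt.stub_coarseNoIntruder` is obtained from the theorems below by `fun k => coarseNoIntruder_of_handover_two hU hB k`).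
* 3a′ `CoarseHandoverUpper L0` (UV′-upper; XL; ONE DIRECTION; zero-mode-agnostic cutoff universality): at matched two-loop label `λ(β',L0) = λ(β,L)` the fine
  decay rate per physical time of level `k` is ≥ the coarse one − `ελ`, eventually in `L`, for every `ε > 0` (cross-multiplied, junk-robust).
* 3b′ `CoarseNoIntruderAt L0` (BOTTOM-upper; L; FINITE-DIMENSIONAL; ONE-free): the text of KT's stub at the SINGLE lattice size `L0` — Lüscher's law from below,
  relative error `o(1)`, for the zero-flux transfer operator on the fixed compact manifold `SU(2)^{3L0³}` as `β → ∞`, against `levelGap k` directly.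
* `CoarseLowerAt L0` (BOTTOM-lower; finite-dimensional; used only in the converse).
* `MatchedCoupling L0` + its PROOF `matchedCoupling` (IVT on the explicit two-loop label `invRunningCoupling`), `FixedLatticeReductionAt L0` (= tree
  `Birth.FixedLatticeReduction` at one size).
* THE SEAM `coarseNoIntruder_of_handover : MatchedCoupling L0 → CoarseHandoverUpper L0 → CoarseNoIntruderAt L0 → KTCoarseNoIntruder` and
  `coarseNoIntruder_of_handover_two : CoarseHandoverUpper 2 → CoarseNoIntruderAt 2 → KTCoarseNoIntruder`;
  the CONVERSE `coarseHandoverUpper_of_coarseNoIntruder : KTCoarseNoIntruder → CoarseLowerAt L0 → CoarseHandoverUpper L0` (3a′ ⟺ stub 3 modulo the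
  fixed-lattice pair {3b′, `CoarseLowerAt L0`}: lossless; neither piece alone gives the stub — 3b′ is not a consequence of RED, ONE or stub 3, all eventually-in-`L`);
  the CALIBRATION `coarseNoIntruderAt_of_fixedLattice : FixedLatticeReductionAt L0 → OneSiteLevels → CoarseNoIntruderAt L0` and `coarseLowerAt_of_fixedLattice`
  (both BOTTOM directions follow from believed-true inputs the route already wants; the intended proof of 3b′ is DIRECT finite-dimensional semiclassics, ONE-free).

## How KT would consume it (crux-plan seat's call; owner blueprint §4.1(3): «only if the composition stays ≤ 7 stubs and the glue is proved»)
Replace `stub_coarseNoIntruder : CoarseNoIntruder` by `stub_coarseHandoverUpper2 : CoarseHandoverUpper 2` (XL) and `stub_coarseNoIntruderAt2 : CoarseNoIntruderAt 2` (L)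
and derive the old stub in-file as `coarseNoIntruder_of_handover_two stub_coarseHandoverUpper2 stub_coarseNoIntruderAt2` — KT then has 6 stubs ≤ 7; `RunningReduction_of`
is untouched.  ORTHOGONAL to sub-line C-c (`twisted-trace-tauberian`, trace currency, partner `L0 = 1`) and to the aniso split of `slab-decimation-aniso` (time/space anisotropy on
the SAME lattice); C-a (IMS/valley localisation, direct) would prove 3a′+3b′'s composite head-on.  WHY 3a′ IS EASIER THAN STUB 3: stub 3 asks the uniform-in-`L` argument to OUTPUT
`𝔥`'s numbers `Δ_k`; 3a′ asks it only to COMPARE two lattice theories of the same kind in the same physical volume (same torons, same flux projection, same slow manifold —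
conjugate the slow sectors, never diagonalise them) and only from one side; `Δ_k` enters solely through 3b′, a statement about one operator on `L²(SU(2)^{24})^{phys}`.
-/

noncomputable section

namespace Summit.QuantumFields.YangMills.Cruxes.RunningReduction.KTCoarseHandover

open MeasureTheory Filter Topology Real
open Literature.MathematicalPhysics.QuantumFieldTheory
open Literature.MathematicalPhysics.QuantumLattice
open Literature.Analysis.OperatorTheory.YMMatrixModel
open Summit.QuantumFields.YangMills.Theorems.FemtoTransferGap
open Summit.QuantumFields.YangMills.Cruxes.RunningReduction.Birth (FixedLatticeReduction)

/-! ## The matching of two-loop labels (support, PROVED) and the fixed-lattice restriction of tree `FixedLatticeReduction` -/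

/-- **`MatchedCoupling L0` (support, S)**: every fine window point `(L,β)` has a coarse partner `β' ≥ 1` with the same two-loop label,
`λ(β',L0) = λ(β,L)`, once `lam` is small.  Proof sketch: `β ↦ invRunningCoupling β L0 = β/2 − 2b₀ log L0 + (b₁/b₀) log(2b₀/β)` is continuous and
increasing on `[1,∞)` with limit `+∞`, so `β ↦ λ(β,L0)` is continuous on `{invRunningCoupling > 0}` and decreases to `0`: IVT. -/
def MatchedCoupling (L0 : ℕ) : Prop :=
  ∃ lamM : ℝ, 0 < lamM ∧ ∀ lam : ℝ, 0 < lam → lam ≤ lamM →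
    ∀ (L : ℕ) [NeZero L] (β : ℝ), InFemtoWindow lam β L → ∃ β' : ℝ, 1 ≤ β' ∧ luscherLambda β' L0 = luscherLambda β L


/-- **BOTTOM = `FixedLatticeReductionAt L0` (crux of Card C, finite-dimensional)**: tree `Birth.FixedLatticeReduction` at the single lattice size
`L0` — spectral Born–Oppenheimer for the Kogut–Susskind-type transfer operator on the FIXED compact manifold `SU(2)^{3L0³}` as `β → ∞`. -/
def FixedLatticeReductionAt (L0 : ℕ) [NeZero L0] : Prop :=
  ∀ k : ℕ, ∃ C lam0 : ℝ, 0 < lam0 ∧ ∀ lam : ℝ, 0 < lam → lam ≤ lam0 → ∀ β : ℝ, InFemtoWindow lam β L0 →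
    levelValue su2Rep L0 β k * levelValue su2Rep 1 (oneSiteCoupling β L0) 0 ≤
        Real.exp (C * luscherLambda β L0 ^ 2 / L0) * (levelValue su2Rep 1 (oneSiteCoupling β L0) k * levelValue su2Rep L0 β 0) ∧
      levelValue su2Rep 1 (oneSiteCoupling β L0) k * levelValue su2Rep L0 β 0 ≤
        Real.exp (C * luscherLambda β L0 ^ 2 / L0) * (levelValue su2Rep L0 β k * levelValue su2Rep 1 (oneSiteCoupling β L0) 0)

theorem fixedLatticeReductionAt_of_fixedLatticeReduction (h : FixedLatticeReduction) (L0 : ℕ) [NeZero L0] :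
    FixedLatticeReductionAt L0 := fun k => h L0 k

/-! ### `MatchedCoupling L0` HOLDS (proved): IVT on the explicit two-loop label -/

theorem b0_pos : 0 < b0 := by unfold b0; positivity
theorem b1_pos : 0 < b1 := by unfold b1; positivity

/-- `b₁/(2b₀²) = 51/121` (the docstring of `b1`). -/
theorem b1_div_two_b0_sq : b1 / (2 * b0 ^ 2) = 51 / 121 := by
  unfold b0 b1
  have hπ : (π : ℝ) ≠ 0 := Real.pi_ne_zero
  field_simp
  ring

/-- Linear lower bound `1/ḡ²(β, L0) ≥ (19/242)·β − 2b₀·log L0` for `β > 0` (from `log x ≤ x − 1`). -/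
theorem invRunningCoupling_ge {β : ℝ} (hβ : 0 < β) (L0 : ℕ) :
    19 / 242 * β - 2 * b0 * Real.log (L0 : ℝ) ≤ invRunningCoupling β L0 := by
  have hb0 := b0_pos
  have hb1 := b1_pos
  have hb0ne : b0 ≠ 0 := hb0.ne'
  set t := Real.log (2 * b0 / β) with ht
  have hlog : 1 - β / (2 * b0) ≤ t := by
    have hx : 0 < β / (2 * b0) := div_pos hβ (mul_pos two_pos hb0)
    have h1 := Real.log_le_sub_one_of_pos hx
    have h2 : Real.log (2 * b0 / β) = -Real.log (β / (2 * b0)) := by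
      rw [← Real.log_inv, inv_div]
    rw [ht, h2]; linarith
  have hid : invRunningCoupling β L0 = -2 * b0 * Real.log (L0 : ℝ) + β / 2 + (b1 / b0) * t := by
    unfold invRunningCoupling sizeLog; rw [← ht]; field_simp; ring
  have hc : (b1 / b0) * (1 - β / (2 * b0)) ≤ (b1 / b0) * t := mul_le_mul_of_nonneg_left hlog (div_pos hb1 hb0).le
  have hc2 : (b1 / b0) * (1 - β / (2 * b0)) = b1 / b0 - (b1 / (2 * b0 ^ 2)) * β := by field_simp
  rw [hc2, b1_div_two_b0_sq] at hc
  have hpos : 0 < b1 / b0 := div_pos hb1 hb0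
  rw [hid]
  linarith

/-- **`MatchedCoupling L0` (proved)**: the coarse partner `β' ≥ 1` with `λ(β',L0) = λ(β,L)` exists once `lam ≤ λ(β₁,L0)/2`,
`β₁ = (242/19)(2b₀ log L0 + 1) + 1`; by the intermediate value theorem for `β ↦ 1/ḡ²(β,L0)` on `[β₁, β₁ + (242/19)λ⁻³]`. -/
theorem matchedCoupling (L0 : ℕ) [NeZero L0] : MatchedCoupling L0 := by
  have hb0 := b0_pos
  have hlogL : 0 ≤ Real.log (L0 : ℝ) := Real.log_nonneg (by exact_mod_cast NeZero.one_le)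
  have hbl : 0 ≤ 2 * b0 * Real.log (L0 : ℝ) := mul_nonneg (mul_nonneg two_pos.le hb0.le) hlogL
  set f : ℝ → ℝ := fun β => invRunningCoupling β L0 with hf
  set β₁ : ℝ := 242 / 19 * (2 * b0 * Real.log (L0 : ℝ) + 1) + 1 with hβ₁
  have hβ₁1 : 1 ≤ β₁ := by rw [hβ₁]; nlinarith
  have hβ₁pos : 0 < β₁ := lt_of_lt_of_le one_pos hβ₁1
  have hf₁ : 1 ≤ f β₁ := by
    have h1 := invRunningCoupling_ge hβ₁pos L0
    have h2 : 19 / 242 * β₁ - 2 * b0 * Real.log (L0 : ℝ) = 1 + 19 / 242 := by rw [hβ₁]; ring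
    show 1 ≤ invRunningCoupling β₁ L0
    linarith
  have hf₁pos : 0 < f β₁ := by linarith
  have hlam₁ : luscherLambda β₁ L0 = (f β₁) ^ (-(1 : ℝ) / 3) := by
    show (max (invRunningCoupling β₁ L0) 0) ^ (-(1 : ℝ) / 3) = (invRunningCoupling β₁ L0) ^ (-(1 : ℝ) / 3)
    rw [max_eq_left hf₁pos.le]
  have hl₁pos : 0 < luscherLambda β₁ L0 := by rw [hlam₁]; exact Real.rpow_pos_of_pos hf₁pos _
  refine ⟨luscherLambda β₁ L0 / 2, by positivity, ?_⟩
  intro lam hlam hle L _ β hw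
  set v : ℝ := luscherLambda β L with hv
  have hvpos : 0 < v := luscherLambda_pos_of_window hlam hw
  have hvle : v ≤ luscherLambda β₁ L0 := by have := hw.2.2; linarith
  set y : ℝ := (v ^ 3)⁻¹ with hy
  have hypos : 0 < y := by positivity
  -- f β₁ ≤ y, i.e. v ≤ λ(β₁, L0)
  have hf₁y : f β₁ ≤ y := by
    rw [hlam₁] at hvle
    have h3 : v ^ 3 ≤ ((f β₁) ^ (-(1 : ℝ) / 3)) ^ 3 := by gcongr
    have h4 : ((f β₁) ^ (-(1 : ℝ) / 3)) ^ 3 = (f β₁)⁻¹ := by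
      rw [← Real.rpow_natCast, ← Real.rpow_mul hf₁pos.le]
      norm_num [Real.rpow_neg_one]
    rw [h4] at h3
    exact (le_inv_comm₀ (by positivity) hf₁pos).mp h3
  -- the upper point
  set β₂ : ℝ := β₁ + 242 / 19 * y with hβ₂
  have h12 : β₁ ≤ β₂ := by rw [hβ₂]; linarith
  have hf₂ : y ≤ f β₂ := by
    have h1 := invRunningCoupling_ge (lt_of_lt_of_le hβ₁pos h12) L0
    have h2 : 19 / 242 * β₂ - 2 * b0 * Real.log (L0 : ℝ) = y + 1 + 19 / 242 := by rw [hβ₂, hβ₁]; ring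
    show y ≤ invRunningCoupling β₂ L0
    linarith
  -- continuity of `f` on `[β₁, β₂]`
  have hne : ∀ x ∈ Set.Icc β₁ β₂, x ≠ 0 := fun x hx => (lt_of_lt_of_le hβ₁pos hx.1).ne'
  have hcont : ContinuousOn f (Set.Icc β₁ β₂) := by
    show ContinuousOn (fun β : ℝ => invRunningCoupling β L0) (Set.Icc β₁ β₂)
    unfold invRunningCoupling sizeLog
    apply ContinuousOn.mul continuousOn_const
    apply ContinuousOn.sub
    · exact ContinuousOn.sub continuousOn_const (continuousOn_id.div_const _)
    · apply ContinuousOn.mul continuousOn_const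
      apply ContinuousOn.log
      · exact continuousOn_const.div continuousOn_id hne
      · intro x hx; exact div_ne_zero (mul_pos two_pos hb0).ne' (hne x hx)
  -- IVT
  obtain ⟨β', hβ'mem, hβ'eq⟩ := intermediate_value_Icc h12 hcont ⟨hf₁y, hf₂⟩
  refine ⟨β', hβ₁1.trans hβ'mem.1, ?_⟩
  have hfβ' : invRunningCoupling β' L0 = y := hβ'eq
  show (max (invRunningCoupling β' L0) 0) ^ (-(1 : ℝ) / 3) = v
  rw [hfβ', max_eq_left hypos.le, hy]
  have hexp : (-(1 : ℝ) / 3) = -(((3 : ℕ) : ℝ)⁻¹) := by norm_num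
  rw [hexp, Real.rpow_neg (by positivity), Real.inv_rpow (by positivity), inv_inv,
    Real.pow_rpow_inv_natCast hvpos.le (by norm_num)]


/-! ## The KT-currency hand-over: 3a′ `CoarseHandoverUpper L0`, 3b′ `CoarseNoIntruderAt L0`, the seam onto KT's stub 3, its converse, and the calibration -/

/-- VERBATIM copy of `Summit.QuantumFields.YangMills.Cruxes.RunningReduction.KT.CoarseNoIntruder` (`Lines-KT.lean` §1; that file lives in the owner's pub
folder and is registered from there, hence not importable here — the text below is character-identical under the same `open`s, so the seam below
re-targets to `KT.Stmt.stub_coarseNoIntruder` by `Iff.rfl` once both sit in one file). -/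
def KTCoarseNoIntruder : Prop :=
  ∀ k : ℕ, ∀ d : ℝ, d < levelGap k → ∃ lam0 : ℝ, 0 < lam0 ∧ ∀ lam : ℝ, 0 < lam → lam ≤ lam0 →
    ∃ L0 : ℕ, ∀ (L : ℕ) [NeZero L], L0 ≤ L → ∀ β : ℝ, InFemtoWindow lam β L →
      levelValue su2Rep L β k ≤ Real.exp (-(d * luscherLambda β L) / L) * levelValue su2Rep L β 0

/-- **UV′-upper = `CoarseHandoverUpper L0` (XL, the proposed stub 3a′ of line «KT»)**: the no-intruder DIRECTION of the (coarse) spectral hand-over of card `handover-split` alone —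
at matched two-loop label the `k`-th spectral ratio of the fine femto torus per physical time is bounded ABOVE by the coarse one times `e^{ελ}`,
for every `ε > 0`, uniformly in `L ≥ L1(lam)` (RED's quantifier order; cross-multiplied). -/
def CoarseHandoverUpper (L0 : ℕ) [NeZero L0] : Prop :=
  ∀ k : ℕ, ∀ ε : ℝ, 0 < ε → ∃ lam0 : ℝ, 0 < lam0 ∧ ∀ lam : ℝ, 0 < lam → lam ≤ lam0 →
    ∃ L1 : ℕ, ∀ (L : ℕ) [NeZero L], L1 ≤ L → ∀ β : ℝ, InFemtoWindow lam β L →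
      ∀ β' : ℝ, 1 ≤ β' → luscherLambda β' L0 = luscherLambda β L →
        levelValue su2Rep L β k ^ L * levelValue su2Rep L0 β' 0 ^ L0 ≤
          Real.exp (ε * luscherLambda β L) * (levelValue su2Rep L0 β' k ^ L0 * levelValue su2Rep L β 0 ^ L)

/-- **BOTTOM-upper = `CoarseNoIntruderAt L0` (L, finite-dimensional, the proposed stub 3b′ of line «KT»)**: Lüscher's law from below with relative error
`o(1)` on the SINGLE lattice size `L0` — for every `d < Δ_k`, once `lam` is small, every `β` in the femto window AT `L0` has
`λ_k(L0,β) ≤ e^{−dλ(β,L0)/L0} λ_0(L0,β)`.  No one-site model, no `ONE`, no limit `L → ∞`: semiclassics (`β → ∞`) of the zero-flux transfer operator on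
the fixed compact manifold `SU(2)^{3L0³}`, whose slow manifold is the toron torus and whose blow-up at the torons is `λ·𝔥/L0`. -/
def CoarseNoIntruderAt (L0 : ℕ) [NeZero L0] : Prop :=
  ∀ k : ℕ, ∀ d : ℝ, d < levelGap k → ∃ lam0 : ℝ, 0 < lam0 ∧ ∀ lam : ℝ, 0 < lam → lam ≤ lam0 →
    ∀ β : ℝ, InFemtoWindow lam β L0 →
      levelValue su2Rep L0 β k ≤ Real.exp (-(d * luscherLambda β L0) / L0) * levelValue su2Rep L0 β 0

/-- **BOTTOM-lower = `CoarseLowerAt L0`** (finite-dimensional; used only in the converse): on the single lattice size `L0`, for every `ε > 0`, eventually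
`e^{−(Δ_k+ε)λ/L0} λ_0 ≤ λ_k`. -/
def CoarseLowerAt (L0 : ℕ) [NeZero L0] : Prop :=
  ∀ k : ℕ, ∀ ε : ℝ, 0 < ε → ∃ lam0 : ℝ, 0 < lam0 ∧ ∀ lam : ℝ, 0 < lam → lam ≤ lam0 →
    ∀ β : ℝ, InFemtoWindow lam β L0 →
      Real.exp (-((levelGap k + ε) * luscherLambda β L0) / L0) * levelValue su2Rep L0 β 0 ≤ levelValue su2Rep L0 β k

/-- `exp(x/n)^n = exp x` for a lattice size `n`. -/
private theorem exp_div_pow (x : ℝ) (n : ℕ) [NeZero n] : Real.exp (x / n) ^ n = Real.exp x := by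
  have hn : (n : ℝ) ≠ 0 := Nat.cast_ne_zero.mpr (NeZero.ne n)
  rw [← Real.exp_nat_mul]; congr 1; field_simp

set_option maxHeartbeats 400000 in
/-- **The KT-currency hand-over composition (proved): `MatchedCoupling L0 → CoarseHandoverUpper L0 → CoarseNoIntruderAt L0 → KT.CoarseNoIntruder`.**
Given `d < Δ_k` put `ε = (Δ_k − d)/2`, `d' = d + ε < Δ_k`; in the window take the coarse partner `β'` (`λ(β',L0) = λ(β,L) =: l`, so `(L0,β')` is in the
window at `L0`); BOTTOM at `d'` raised to the power `L0` gives `λ'_k^{L0} ≤ e^{−d'l} λ'_0^{L0}`, UV′-upper gives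
`λ_k^L λ'_0^{L0} ≤ e^{εl} λ'_k^{L0} λ_0^L ≤ e^{−dl} λ'_0^{L0} λ_0^L`; cancel `λ'_0^{L0} > 0` and take the `L`-th root. -/
theorem coarseNoIntruder_of_handover (L0 : ℕ) [NeZero L0] (hM : MatchedCoupling L0) (hU : CoarseHandoverUpper L0)
    (hB : CoarseNoIntruderAt L0) : KTCoarseNoIntruder := by
  intro k d hd
  obtain ⟨lamM, hlamM, HM⟩ := hM
  set ε : ℝ := (levelGap k - d) / 2 with hε_def
  have hε : 0 < ε := by rw [hε_def]; linarith
  set d' : ℝ := d + ε with hd'_def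
  have hd' : d' < levelGap k := by rw [hd'_def, hε_def]; linarith
  obtain ⟨lU, hlU, HU⟩ := hU k ε hε
  obtain ⟨lB, hlB, HB⟩ := hB k d' hd'
  refine ⟨min lamM (min lU lB), lt_min hlamM (lt_min hlU hlB), ?_⟩
  intro lam hlam hle
  have hleM : lam ≤ lamM := hle.trans (min_le_left _ _)
  have hleU : lam ≤ lU := (hle.trans (min_le_right _ _)).trans (min_le_left _ _)
  have hleB : lam ≤ lB := (hle.trans (min_le_right _ _)).trans (min_le_right _ _)
  obtain ⟨L1, HL⟩ := HU lam hlam hleU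
  refine ⟨L1, ?_⟩
  intro L _ hL β hw
  have hβ1 : 1 ≤ β := hw.1
  obtain ⟨β', hβ'1, hmatch⟩ := HM lam hlam hleM L β hw
  have hw' : InFemtoWindow lam β' L0 := by
    refine ⟨hβ'1, ?_, ?_⟩
    · rw [hmatch]; exact hw.2.1
    · rw [hmatch]; exact hw.2.2
  have hU1 := HL L hL β hw β' hβ'1 hmatch
  have hB1 := HB lam hlam hleB β' hw'
  rw [hmatch] at hB1
  set l : ℝ := luscherLambda β L with hl_def
  set xk := levelValue su2Rep L β k with hxk_def
  set x0 := levelValue su2Rep L β 0 with hx0_def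
  set yk := levelValue su2Rep L0 β' k with hyk_def
  set y0 := levelValue su2Rep L0 β' 0 with hy0_def
  have hxk : 0 ≤ xk := transferValuesNonneg L β k hβ1
  have hx0 : 0 < x0 := levelValue_zero_su2Rep_pos L β
  have hyk : 0 ≤ yk := transferValuesNonneg L0 β' k hβ'1
  have hy0 : 0 < y0 := levelValue_zero_su2Rep_pos L0 β'
  -- BOTTOM to the power L0
  have hBp : yk ^ L0 ≤ Real.exp (-(d' * l)) * y0 ^ L0 := by
    have := pow_le_pow_left₀ hyk hB1 L0
    rwa [mul_pow, exp_div_pow] at this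
  have hexp : Real.exp (ε * l) * Real.exp (-(d' * l)) = Real.exp (-(d * l)) := by
    rw [← Real.exp_add]; congr 1; rw [hd'_def]; ring
  have key : xk ^ L * y0 ^ L0 ≤ Real.exp (-(d * l)) * x0 ^ L * y0 ^ L0 := by
    calc xk ^ L * y0 ^ L0 ≤ Real.exp (ε * l) * (yk ^ L0 * x0 ^ L) := hU1
      _ ≤ Real.exp (ε * l) * ((Real.exp (-(d' * l)) * y0 ^ L0) * x0 ^ L) :=
          mul_le_mul_of_nonneg_left (mul_le_mul_of_nonneg_right hBp (pow_nonneg hx0.le _)) (Real.exp_pos _).le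
      _ = (Real.exp (ε * l) * Real.exp (-(d' * l))) * x0 ^ L * y0 ^ L0 := by ring
      _ = Real.exp (-(d * l)) * x0 ^ L * y0 ^ L0 := by rw [hexp]
  have hpos : 0 < y0 ^ L0 := pow_pos hy0 L0
  have key2 : xk ^ L ≤ Real.exp (-(d * l)) * x0 ^ L := le_of_mul_le_mul_right key hpos
  -- L-th root
  have key3 : xk ^ L ≤ (Real.exp (-(d * l) / L) * x0) ^ L := by rwa [mul_pow, exp_div_pow]
  exact (pow_le_pow_iff_left₀ hxk (mul_nonneg (Real.exp_pos _).le hx0.le) (NeZero.ne L)).mp key3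

/-- At the canonical coarse size, with the matching discharged: **`CoarseHandoverUpper 2 → CoarseNoIntruderAt 2 → KT.CoarseNoIntruder`** (proved). -/
theorem coarseNoIntruder_of_handover_two (hU : CoarseHandoverUpper 2) (hB : CoarseNoIntruderAt 2) : KTCoarseNoIntruder :=
  coarseNoIntruder_of_handover 2 (matchedCoupling 2) hU hB

set_option maxHeartbeats 400000 in
/-- **Faithfulness in KT currency (proved): `KT.CoarseNoIntruder → CoarseLowerAt L0 → CoarseHandoverUpper L0`.**  Fine side at `d = Δ_k − ε/2` to the
power `L`, coarse lower bound at `ε/2` to the power `L0`, multiply.  So UV′-upper(L0) is EQUIVALENT to KT's XL stub modulo the fixed-lattice pair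
{`CoarseNoIntruderAt L0`, `CoarseLowerAt L0`} (both finite-dimensional, `β → ∞` on `SU(2)^{3L0³}`): the split is lossless and costume-free
(neither piece alone gives the stub). -/
theorem coarseHandoverUpper_of_coarseNoIntruder (L0 : ℕ) [NeZero L0] (hC : KTCoarseNoIntruder) (hLow : CoarseLowerAt L0) :
    CoarseHandoverUpper L0 := by
  intro k ε hε
  obtain ⟨lC, hlC, HC⟩ := hC k (levelGap k - ε / 2) (by linarith)
  obtain ⟨lW, hlW, HW⟩ := hLow k (ε / 2) (by linarith)
  refine ⟨min lC lW, lt_min hlC hlW, ?_⟩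
  intro lam hlam hle
  obtain ⟨L1, HL⟩ := HC lam hlam (hle.trans (min_le_left _ _))
  refine ⟨L1, ?_⟩
  intro L _ hL β hw β' hβ'1 hmatch
  have hβ1 : 1 ≤ β := hw.1
  have hw' : InFemtoWindow lam β' L0 := by
    refine ⟨hβ'1, ?_, ?_⟩
    · rw [hmatch]; exact hw.2.1
    · rw [hmatch]; exact hw.2.2
  have hC1 := HL L hL β hw
  have hW1 := HW lam hlam (hle.trans (min_le_right _ _)) β' hw'
  rw [hmatch] at hW1
  set l : ℝ := luscherLambda β L with hl_def
  set xk := levelValue su2Rep L β k with hxk_def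
  set x0 := levelValue su2Rep L β 0 with hx0_def
  set yk := levelValue su2Rep L0 β' k with hyk_def
  set y0 := levelValue su2Rep L0 β' 0 with hy0_def
  have hxk : 0 ≤ xk := transferValuesNonneg L β k hβ1
  have hx0 : 0 < x0 := levelValue_zero_su2Rep_pos L β
  have hy0 : 0 < y0 := levelValue_zero_su2Rep_pos L0 β'
  have hCp : xk ^ L ≤ Real.exp (-((levelGap k - ε / 2) * l)) * x0 ^ L := by
    have := pow_le_pow_left₀ hxk hC1 L
    rwa [mul_pow, exp_div_pow] at this
  have hWp : Real.exp (-((levelGap k + ε / 2) * l)) * y0 ^ L0 ≤ yk ^ L0 := by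
    have := pow_le_pow_left₀ (mul_nonneg (Real.exp_pos _).le hy0.le) hW1 L0
    rwa [mul_pow, exp_div_pow] at this
  have hexp : Real.exp (-((levelGap k - ε / 2) * l)) = Real.exp (ε * l) * Real.exp (-((levelGap k + ε / 2) * l)) := by
    rw [← Real.exp_add]; congr 1; ring
  calc xk ^ L * y0 ^ L0 ≤ (Real.exp (-((levelGap k - ε / 2) * l)) * x0 ^ L) * y0 ^ L0 :=
        mul_le_mul_of_nonneg_right hCp (pow_nonneg hy0.le _)
    _ = Real.exp (ε * l) * ((Real.exp (-((levelGap k + ε / 2) * l)) * y0 ^ L0) * x0 ^ L) := by rw [hexp]; ring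
    _ ≤ Real.exp (ε * l) * (yk ^ L0 * x0 ^ L) :=
        mul_le_mul_of_nonneg_left (mul_le_mul_of_nonneg_right hWp (pow_nonneg hx0.le _)) (Real.exp_pos _).le

/-! ### BOTTOM-coarse is believed-true input: both fixed-lattice directions follow from tree `FixedLatticeReduction` at `L0` and the route's crux ONE
(proved).  This only CALIBRATES the pieces (they are not stronger than what the route already wants); the intended proof of `CoarseNoIntruderAt L0`
is direct finite-dimensional semiclassics against `𝔥`, without the one-site model. -/

/-- Slack absorption: `C₂ l²/L0 + C₁ (l/L0)² ≤ g·l/L0` once `l ≤ 2 lam ≤ g/(|C₁|+|C₂|+1)`. -/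
private theorem slack_absorb {C₁ C₂ g l lam : ℝ} {L0 : ℕ} [NeZero L0] (hl : 0 < l) (hl2 : l ≤ 2 * lam)
    (hlam : lam ≤ g / (2 * (|C₁| + |C₂| + 1))) :
    C₂ * l ^ 2 / L0 + C₁ * (l / L0) ^ 2 ≤ g * l / L0 := by
  have hL0one : (1 : ℝ) ≤ L0 := by exact_mod_cast NeZero.one_le
  have hL0pos : (0 : ℝ) < L0 := by positivity
  have hA : 0 < |C₁| + |C₂| + 1 := by positivity
  have hlg : (|C₁| + |C₂| + 1) * l ≤ g := by
    have h2lam : 2 * lam ≤ g / (|C₁| + |C₂| + 1) := by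
      have := mul_le_mul_of_nonneg_left hlam (by norm_num : (0 : ℝ) ≤ 2)
      calc 2 * lam ≤ 2 * (g / (2 * (|C₁| + |C₂| + 1))) := this
        _ = g / (|C₁| + |C₂| + 1) := by field_simp
    calc (|C₁| + |C₂| + 1) * l ≤ (|C₁| + |C₂| + 1) * (g / (|C₁| + |C₂| + 1)) :=
          mul_le_mul_of_nonneg_left (hl2.trans h2lam) hA.le
      _ = g := by field_simp
  have h1 : C₂ * l ^ 2 / L0 ≤ |C₂| * l ^ 2 / L0 := by gcongr; exact le_abs_self _
  have h2 : C₁ * (l / L0) ^ 2 ≤ |C₁| * l ^ 2 / L0 := by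
    have h21 : C₁ * (l / L0) ^ 2 ≤ |C₁| * (l / L0) ^ 2 := mul_le_mul_of_nonneg_right (le_abs_self _) (sq_nonneg _)
    have h22 : |C₁| * (l / L0) ^ 2 ≤ |C₁| * l ^ 2 / L0 := by
      rw [div_pow, ← mul_div_assoc]
      apply div_le_div_of_nonneg_left (mul_nonneg (abs_nonneg _) (sq_nonneg l)) hL0pos
      nlinarith
    exact h21.trans h22
  have h4 : (|C₁| + |C₂|) * l ≤ g := by nlinarith [hlg, hl]
  calc C₂ * l ^ 2 / L0 + C₁ * (l / L0) ^ 2 ≤ |C₂| * l ^ 2 / L0 + |C₁| * l ^ 2 / L0 := add_le_add h1 h2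
    _ = ((|C₁| + |C₂|) * l) * l / L0 := by ring
    _ ≤ g * l / L0 := by gcongr

/-- In the window at `L0` with `lam ≤ min 1 (1/(4M))`: `M ≤ oneSiteCoupling β L0`. -/
private theorem oneSiteCoupling_ge_of_small {lam β M : ℝ} {L0 : ℕ} [NeZero L0] (hM : 0 < M) (hlam : 0 < lam) (hlam1 : lam ≤ 1)
    (hleM : lam ≤ 1 / (4 * M)) (hw : InFemtoWindow lam β L0) : M ≤ oneSiteCoupling β L0 := by
  have h := oneSiteCoupling_ge_of_window hlam hw
  refine le_trans ?_ h
  rw [le_div_iff₀ (by positivity)]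
  have hlam3 : lam ^ 3 ≤ lam := pow_le_of_le_one hlam.le hlam1 three_ne_zero
  have h3 := hleM
  rw [le_div_iff₀ (by positivity)] at h3
  calc M * (4 * lam ^ 3) = 4 * M * lam ^ 3 := by ring
    _ ≤ 4 * M * lam := by gcongr
    _ = lam * (4 * M) := by ring
    _ ≤ 1 := h3

set_option maxHeartbeats 400000 in
/-- **Calibration (proved): `FixedLatticeReductionAt L0 → ONE → CoarseNoIntruderAt L0`.** -/
theorem coarseNoIntruderAt_of_fixedLattice (L0 : ℕ) [NeZero L0] (hF : FixedLatticeReductionAt L0)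
    (hOne : Summit.QuantumFields.YangMills.Theses.LuscherReduction.OneSiteLevels) : CoarseNoIntruderAt L0 := by
  intro k d hd
  obtain ⟨C₁, B0, H₁⟩ := hOne k
  obtain ⟨C₂, l₂, hl₂, H₂⟩ := hF k
  set g : ℝ := levelGap k - d with hg_def
  have hg : 0 < g := by rw [hg_def]; linarith
  set M : ℝ := max B0 1 with hM_def
  have hM1 : 1 ≤ M := le_max_right _ _
  have hMB : B0 ≤ M := le_max_left _ _
  have hM0 : 0 < M := by linarith
  have hA : 0 < |C₁| + |C₂| + 1 := by positivity
  refine ⟨min l₂ (min 1 (min (1 / (4 * M)) (g / (2 * (|C₁| + |C₂| + 1))))),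
    lt_min hl₂ (lt_min one_pos (lt_min (by positivity) (by positivity))), ?_⟩
  intro lam hlam hle β hw
  have hle₂ : lam ≤ l₂ := hle.trans (min_le_left _ _)
  have hlam1 : lam ≤ 1 := (hle.trans (min_le_right _ _)).trans (min_le_left _ _)
  have hleM : lam ≤ 1 / (4 * M) := ((hle.trans (min_le_right _ _)).trans (min_le_right _ _)).trans (min_le_left _ _)
  have hleg : lam ≤ g / (2 * (|C₁| + |C₂| + 1)) := ((hle.trans (min_le_right _ _)).trans (min_le_right _ _)).trans (min_le_right _ _)
  have hβ1 : 1 ≤ β := hw.1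
  set l : ℝ := luscherLambda β L0 with hl_def
  have hl : 0 < l := luscherLambda_pos_of_window hlam hw
  have hl2 : l ≤ 2 * lam := hw.2.2
  have hL0pos : (0 : ℝ) < L0 := Nat.cast_pos.mpr (NeZero.pos L0)
  set B : ℝ := oneSiteCoupling β L0 with hB_def
  have hBM : M ≤ B := oneSiteCoupling_ge_of_small hM0 hlam hlam1 hleM hw
  have hB0 : B0 ≤ B := hMB.trans hBM
  have hB1 : 1 ≤ B := hM1.trans hBM
  have hlb : bareLambda B = l / L0 := bareLambda_oneSiteCoupling hl
  obtain ⟨hu0, hU, -⟩ := H₁ B hB0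
  rw [hlb] at hU
  obtain ⟨hF1, -⟩ := H₂ lam hlam hle₂ β hw
  set yk := levelValue su2Rep L0 β k with hyk_def
  set y0 := levelValue su2Rep L0 β 0 with hy0_def
  set uk := levelValue su2Rep 1 B k with huk_def
  set u0 := levelValue su2Rep 1 B 0 with hu0_def
  have hy0 : 0 < y0 := levelValue_zero_su2Rep_pos L0 β
  -- chain and cancel u0
  have key : yk * u0 ≤ (Real.exp (C₂ * l ^ 2 / L0) * Real.exp (-(levelGap k * (l / L0) - C₁ * (l / L0) ^ 2))) * y0 * u0 := by
    calc yk * u0 ≤ Real.exp (C₂ * l ^ 2 / L0) * (uk * y0) := hF1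
      _ ≤ Real.exp (C₂ * l ^ 2 / L0) * ((Real.exp (-(levelGap k * (l / L0) - C₁ * (l / L0) ^ 2)) * u0) * y0) :=
          mul_le_mul_of_nonneg_left (mul_le_mul_of_nonneg_right hU hy0.le) (Real.exp_pos _).le
      _ = (Real.exp (C₂ * l ^ 2 / L0) * Real.exp (-(levelGap k * (l / L0) - C₁ * (l / L0) ^ 2))) * y0 * u0 := by ring
  have key2 : yk ≤ (Real.exp (C₂ * l ^ 2 / L0) * Real.exp (-(levelGap k * (l / L0) - C₁ * (l / L0) ^ 2))) * y0 :=
    le_of_mul_le_mul_right key hu0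
  have hslack := slack_absorb (C₁ := C₁) (C₂ := C₂) (L0 := L0) hl hl2 hleg
  have hexp : Real.exp (C₂ * l ^ 2 / L0) * Real.exp (-(levelGap k * (l / L0) - C₁ * (l / L0) ^ 2)) ≤ Real.exp (-(d * l) / L0) := by
    rw [← Real.exp_add]
    apply Real.exp_le_exp.mpr
    have : levelGap k * (l / L0) = (g * l / L0) + d * l / L0 := by rw [hg_def]; ring
    rw [this]
    have : -(d * l) / (L0 : ℝ) = -(d * l / L0) := by ring
    rw [this]
    linarith
  exact key2.trans (mul_le_mul_of_nonneg_right hexp hy0.le)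

set_option maxHeartbeats 400000 in
/-- **Calibration (proved): `FixedLatticeReductionAt L0 → ONE → CoarseLowerAt L0`.** -/
theorem coarseLowerAt_of_fixedLattice (L0 : ℕ) [NeZero L0] (hF : FixedLatticeReductionAt L0)
    (hOne : Summit.QuantumFields.YangMills.Theses.LuscherReduction.OneSiteLevels) : CoarseLowerAt L0 := by
  intro k ε hε
  obtain ⟨C₁, B0, H₁⟩ := hOne k
  obtain ⟨C₂, l₂, hl₂, H₂⟩ := hF k
  set M : ℝ := max B0 1 with hM_def
  have hM1 : 1 ≤ M := le_max_right _ _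
  have hMB : B0 ≤ M := le_max_left _ _
  have hM0 : 0 < M := by linarith
  have hA : 0 < |C₁| + |C₂| + 1 := by positivity
  refine ⟨min l₂ (min 1 (min (1 / (4 * M)) (ε / (2 * (|C₁| + |C₂| + 1))))),
    lt_min hl₂ (lt_min one_pos (lt_min (by positivity) (by positivity))), ?_⟩
  intro lam hlam hle β hw
  have hle₂ : lam ≤ l₂ := hle.trans (min_le_left _ _)
  have hlam1 : lam ≤ 1 := (hle.trans (min_le_right _ _)).trans (min_le_left _ _)
  have hleM : lam ≤ 1 / (4 * M) := ((hle.trans (min_le_right _ _)).trans (min_le_right _ _)).trans (min_le_left _ _)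
  have hleg : lam ≤ ε / (2 * (|C₁| + |C₂| + 1)) := ((hle.trans (min_le_right _ _)).trans (min_le_right _ _)).trans (min_le_right _ _)
  have hβ1 : 1 ≤ β := hw.1
  set l : ℝ := luscherLambda β L0 with hl_def
  have hl : 0 < l := luscherLambda_pos_of_window hlam hw
  have hl2 : l ≤ 2 * lam := hw.2.2
  have hL0pos : (0 : ℝ) < L0 := Nat.cast_pos.mpr (NeZero.pos L0)
  set B : ℝ := oneSiteCoupling β L0 with hB_def
  have hBM : M ≤ B := oneSiteCoupling_ge_of_small hM0 hlam hlam1 hleM hw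
  have hB0 : B0 ≤ B := hMB.trans hBM
  have hlb : bareLambda B = l / L0 := bareLambda_oneSiteCoupling hl
  obtain ⟨hu0, -, hL⟩ := H₁ B hB0
  rw [hlb] at hL
  obtain ⟨-, hF2⟩ := H₂ lam hlam hle₂ β hw
  set yk := levelValue su2Rep L0 β k with hyk_def
  set y0 := levelValue su2Rep L0 β 0 with hy0_def
  set uk := levelValue su2Rep 1 B k with huk_def
  set u0 := levelValue su2Rep 1 B 0 with hu0_def
  have hy0 : 0 < y0 := levelValue_zero_su2Rep_pos L0 β
  have hyk : 0 ≤ yk := transferValuesNonneg L0 β k hβ1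
  -- (e^{-(Δ l/L0 + C₁ (l/L0)²)} u0) y0 ≤ uk y0 ≤ e^{C₂ l²/L0} yk u0
  have key : (Real.exp (-(levelGap k * (l / L0) + C₁ * (l / L0) ^ 2)) * y0) * u0 ≤ (Real.exp (C₂ * l ^ 2 / L0) * yk) * u0 := by
    calc (Real.exp (-(levelGap k * (l / L0) + C₁ * (l / L0) ^ 2)) * y0) * u0
        = (Real.exp (-(levelGap k * (l / L0) + C₁ * (l / L0) ^ 2)) * u0) * y0 := by ring
      _ ≤ uk * y0 := mul_le_mul_of_nonneg_right hL hy0.le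
      _ ≤ Real.exp (C₂ * l ^ 2 / L0) * (yk * u0) := hF2
      _ = (Real.exp (C₂ * l ^ 2 / L0) * yk) * u0 := by ring
  have key2 : Real.exp (-(levelGap k * (l / L0) + C₁ * (l / L0) ^ 2)) * y0 ≤ Real.exp (C₂ * l ^ 2 / L0) * yk :=
    le_of_mul_le_mul_right key hu0
  -- divide by e^{C₂ l²/L0}
  have key3 : Real.exp (-(levelGap k * (l / L0) + C₁ * (l / L0) ^ 2) - C₂ * l ^ 2 / L0) * y0 ≤ yk := by
    have hE : Real.exp (-(levelGap k * (l / L0) + C₁ * (l / L0) ^ 2) - C₂ * l ^ 2 / L0) =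
        Real.exp (-(levelGap k * (l / L0) + C₁ * (l / L0) ^ 2)) / Real.exp (C₂ * l ^ 2 / L0) := by
      rw [Real.exp_sub]
    rw [hE, div_mul_eq_mul_div, div_le_iff₀ (Real.exp_pos _)]
    calc Real.exp (-(levelGap k * (l / L0) + C₁ * (l / L0) ^ 2)) * y0 ≤ Real.exp (C₂ * l ^ 2 / L0) * yk := key2
      _ = yk * Real.exp (C₂ * l ^ 2 / L0) := by ring
  have hslack := slack_absorb (C₁ := C₁) (C₂ := C₂) (L0 := L0) hl hl2 hleg
  have hexp : Real.exp (-((levelGap k + ε) * l) / L0) ≤ Real.exp (-(levelGap k * (l / L0) + C₁ * (l / L0) ^ 2) - C₂ * l ^ 2 / L0) := by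
    apply Real.exp_le_exp.mpr
    have : -((levelGap k + ε) * l) / (L0 : ℝ) = -(levelGap k * (l / L0)) - ε * l / L0 := by ring
    rw [this]
    linarith
  exact (mul_le_mul_of_nonneg_right hexp hy0.le).trans key3

end Summit.QuantumFields.YangMills.Cruxes.RunningReduction.KTCoarseHandover
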